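import Summits.Ventures.DiscreteObjects.Hadamard.CompositeOrderStructure668
import Summits.Ventures.DiscreteObjects.Hadamard.ElemAbelianRank2Small

/-!
# Hadamard 668 census, family F12 — structure of (hypothetical) automorphisms of order 111, 123, 65, 77 of an H(668)
# (kernel; counting + the free-orbit bound)

Framing: lottery ticket; floor = certified bounds/negative ranges.

Cell pub-namedobj (venture DiscreteObjects), target (H), hadamard gen 17.  Continuation of `CompositeOrderStructure668`
(orders 143, 91): for a signed automorphism `(π, κ, d, e)` of an H(668) with `π^(pq) = κ^(pq) = 1` and both parts
nontrivial, `counting_cols` (gen 11: `#Fix(κ^p) = p·a + f'`, `#Fix(κ^q) = q·b + f'`, `f' = #(Fix κ^q ∩ Fix κ^p)`), the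
censuses (`census3/5/7/11`, `hadamard668_signedAut_fixedRows`) and the free-orbit bound `composite_fixed_bound`
(`pq·f' ≤ 668`) leave (columns; rows alike):
* **order 111 = 3·37** (`hadamard668_order111_structure`): the `3`-part fixes EXACTLY `2` columns — the two columns
  fixed by the `37`-part (`f₃₇ = 2 = 3a + f'` forces `f' = 2`, and `f₃ = 37b + 2 ∈ {2, 8, …, 164}`, `f₃ ≡ 2 (mod 6)`
  forces `b = 0`); pure counting.
* **order 123 = 3·41** (`hadamard668_order123_structure`): `(f₃, f') ∈ {(164, 0), (44, 3)}` (`f₄₁ = 12 = 3a + f'`,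
  `123·f' ≤ 668`).
* **order 65 = 5·13** (`hadamard668_order65_structure`): `(f₅, f') ∈ {(108, 4), (48, 9)}` (`44 = 5a + f'`, `65·f' ≤ 668`).
* **order 77 = 7·11** (`hadamard668_order77_structure`): `(f₇, f₁₁, f') ∈ {(24, 30, 2), (52, 8, 8), (80, 52, 3)}`
  (`f₁₁ = 7a + f'`, `f₇ = 11b + f'`, `77·f' ≤ 668`).
No order is excluded.  Ours, not literature; no `sorry`.
-/

namespace Summit.Ventures.DiscreteObjects.Hadamard

open Finset BigOperators Matrix

open Literature.Combinatorics.Designs.GoethalsSeidel (IsHadamardMatrix)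

variable {ι : Type*} [Fintype ι] [DecidableEq ι]

section compositeB
variable {H : Matrix ι ι ℤ}

/-- columns, order 111: the 3-part fixes exactly the 2 columns fixed by the 37-part -/
lemma order111_cols (hH : IsHadamardMatrix H) (hι : Fintype.card ι = 668)
    {π κ : Equiv.Perm ι} {d e : ι → ℤ} (haut : IsSignedAut H π κ d e)
    (hπ : π ^ (3 * 37) = 1) (hκ : κ ^ (3 * 37) = 1) (h37 : π ^ 37 ≠ 1 ∨ κ ^ 37 ≠ 1) (h3 : π ^ 3 ≠ 1 ∨ κ ^ 3 ≠ 1) :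
    (univ.filter fun j => (κ ^ 3) j = j).card = 2 ∧ (univ.filter fun j => (κ ^ 37) j = j).card = 2 ∧
    (univ.filter fun j => (κ ^ 37) j = j ∧ (κ ^ 3) j = j).card = 2 := by
  have hcard : (Fintype.card ι : ℤ) ≠ 0 := by rw [hι]; norm_num
  have hπ37 : (π ^ 37) ^ 3 = 1 := by rw [← pow_mul]; exact hπ
  have hκ37 : (κ ^ 37) ^ 3 = 1 := by rw [← pow_mul]; exact hκ
  have hπ3 : (π ^ 3) ^ 37 = 1 := by rw [← pow_mul]; exact hπ
  have hκ3 : (κ ^ 3) ^ 37 = 1 := by rw [← pow_mul]; exact hκ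
  have hne37 : π ^ 37 ≠ 1 := fst_pow_ne_one hH hcard haut (by decide : Odd 3) hκ37 h37
  obtain ⟨⟨cC1, cC2, cCm⟩, -⟩ := census3 hH hι (isSignedAut_pow haut 37) hπ37 hκ37 hne37
  obtain ⟨eRC, h2⟩ := hadamard668_signedAut_fixedRows hH hι 37 (by norm_num) (by norm_num) (π ^ 3) (κ ^ 3) _ _
    (isSignedAut_pow haut 3) hπ3 hκ3 h3
  have h2R : (univ.filter fun i => (π ^ 3) i = i).card = 2 := by
    rcases h2 with ⟨h, -⟩ | ⟨h, -⟩ | ⟨-, h⟩ | ⟨h, -⟩ | ⟨h, -⟩ | ⟨h, -⟩ <;> first | exact h | norm_num at h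
  have h2C : (univ.filter fun j => (κ ^ 3) j = j).card = 2 := by rw [← eRC]; exact h2R
  obtain ⟨c1, ⟨a, ha⟩, c2, ⟨b, hb⟩, l1, -⟩ := counting_cols κ (by norm_num : (3 : ℕ).Prime) (by norm_num : (37 : ℕ).Prime) hκ
  refine ⟨h2C, ?_, ?_⟩ <;> omega

/-- **order 111 = 3·37**: the 3-parts `π^37`, `κ^37` fix EXACTLY 2 rows / 2 columns (those fixed by the 37-parts). -/
theorem hadamard668_order111_structure (hH : IsHadamardMatrix H) (hι : Fintype.card ι = 668)
    (π κ : Equiv.Perm ι) (d e : ι → ℤ) (haut : IsSignedAut H π κ d e)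
    (hπ : π ^ (3 * 37) = 1) (hκ : κ ^ (3 * 37) = 1) (h37 : π ^ 37 ≠ 1 ∨ κ ^ 37 ≠ 1) (h3 : π ^ 3 ≠ 1 ∨ κ ^ 3 ≠ 1) :
    (univ.filter fun i => (π ^ 37) i = i).card = 2 ∧ (univ.filter fun j => (κ ^ 37) j = j).card = 2 ∧
    (univ.filter fun i => (π ^ 37) i = i ∧ (π ^ 3) i = i).card = 2 ∧
    (univ.filter fun j => (κ ^ 37) j = j ∧ (κ ^ 3) j = j).card = 2 := by
  have hcard : (Fintype.card ι : ℤ) ≠ 0 := by rw [hι]; norm_num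
  obtain ⟨-, cC, fC⟩ := order111_cols hH hι haut hπ hκ h37 h3
  obtain ⟨-, cR, fR⟩ := order111_cols (isHadamard_transpose hH hcard) hι (isSignedAut_transpose haut) hκ hπ h37.symm
    h3.symm
  exact ⟨cR, cC, fR, fC⟩

/-- columns, order 123 -/
lemma order123_cols (hH : IsHadamardMatrix H) (hι : Fintype.card ι = 668)
    {π κ : Equiv.Perm ι} {d e : ι → ℤ} (haut : IsSignedAut H π κ d e)
    (hπ : π ^ (3 * 41) = 1) (hκ : κ ^ (3 * 41) = 1) (h41 : π ^ 41 ≠ 1 ∨ κ ^ 41 ≠ 1) (h3 : π ^ 3 ≠ 1 ∨ κ ^ 3 ≠ 1) :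
    ((univ.filter fun j => (κ ^ 41) j = j).card = 164 ∧ (univ.filter fun j => (κ ^ 41) j = j ∧ (κ ^ 3) j = j).card = 0) ∨
    ((univ.filter fun j => (κ ^ 41) j = j).card = 44 ∧ (univ.filter fun j => (κ ^ 41) j = j ∧ (κ ^ 3) j = j).card = 3) := by
  have hcard : (Fintype.card ι : ℤ) ≠ 0 := by rw [hι]; norm_num
  have hπ41 : (π ^ 41) ^ 3 = 1 := by rw [← pow_mul]; exact hπ
  have hκ41 : (κ ^ 41) ^ 3 = 1 := by rw [← pow_mul]; exact hκ
  have hπ3 : (π ^ 3) ^ 41 = 1 := by rw [← pow_mul]; exact hπ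
  have hκ3 : (κ ^ 3) ^ 41 = 1 := by rw [← pow_mul]; exact hκ
  have hne41 : π ^ 41 ≠ 1 := fst_pow_ne_one hH hcard haut (by decide : Odd 3) hκ41 h41
  obtain ⟨⟨cC1, cC2, cCm⟩, ⟨cR1, cR2, cRm⟩⟩ := census3 hH hι (isSignedAut_pow haut 41) hπ41 hκ41 hne41
  obtain ⟨eRC, h12⟩ := hadamard668_signedAut_fixedRows hH hι 41 (by norm_num) (by norm_num) (π ^ 3) (κ ^ 3) _ _
    (isSignedAut_pow haut 3) hπ3 hκ3 h3
  have h12R : (univ.filter fun i => (π ^ 3) i = i).card = 12 := by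
    rcases h12 with ⟨h, -⟩ | ⟨h, -⟩ | ⟨h, -⟩ | ⟨-, h⟩ | ⟨h, -⟩ | ⟨h, -⟩ <;> first | exact h | norm_num at h
  have h12C : (univ.filter fun j => (κ ^ 3) j = j).card = 12 := by rw [← eRC]; exact h12R
  obtain ⟨c1, ⟨a, ha⟩, c2, ⟨b, hb⟩, -, -⟩ := counting_cols κ (by norm_num : (3 : ℕ).Prime) (by norm_num : (41 : ℕ).Prime) hκ
  have hbd := composite_fixed_bound hH hι haut (by norm_num : (3 : ℕ).Prime) (by norm_num : (41 : ℕ).Prime) (by norm_num)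
    (by decide : Odd (3 * 41)) hπ hκ (by omega)
  have hF : (univ.filter fun j => (κ ^ 41) j = j ∧ (κ ^ 3) j = j).card = 0 ∨
      (univ.filter fun j => (κ ^ 41) j = j ∧ (κ ^ 3) j = j).card = 3 := by
    clear cR1 cR2 cRm cC1 cC2 cCm c2 hb h12R eRC; omega
  clear cR1 cR2 cRm h12R
  obtain ⟨t, ht⟩ : ∃ t : ℕ, (univ.filter fun j => (κ ^ 41) j = j).card = 6 * t + 2 :=
    ⟨(univ.filter fun j => (κ ^ 41) j = j).card / 6, by omega⟩
  clear cCm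
  rcases hF with hF | hF
  · left; refine ⟨?_, hF⟩; rw [hF] at c2; omega
  · right; refine ⟨?_, hF⟩; rw [hF] at c2; omega

/-- **order 123 = 3·41**: on the columns `(#Fix κ^41, #(Fix κ^41 ∩ Fix κ^3)) ∈ {(164, 0), (44, 3)}`, and the same on the
rows. -/
theorem hadamard668_order123_structure (hH : IsHadamardMatrix H) (hι : Fintype.card ι = 668)
    (π κ : Equiv.Perm ι) (d e : ι → ℤ) (haut : IsSignedAut H π κ d e)
    (hπ : π ^ (3 * 41) = 1) (hκ : κ ^ (3 * 41) = 1) (h41 : π ^ 41 ≠ 1 ∨ κ ^ 41 ≠ 1) (h3 : π ^ 3 ≠ 1 ∨ κ ^ 3 ≠ 1) :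
    (((univ.filter fun j => (κ ^ 41) j = j).card = 164 ∧ (univ.filter fun j => (κ ^ 41) j = j ∧ (κ ^ 3) j = j).card = 0) ∨
     ((univ.filter fun j => (κ ^ 41) j = j).card = 44 ∧ (univ.filter fun j => (κ ^ 41) j = j ∧ (κ ^ 3) j = j).card = 3)) ∧
    (((univ.filter fun i => (π ^ 41) i = i).card = 164 ∧ (univ.filter fun i => (π ^ 41) i = i ∧ (π ^ 3) i = i).card = 0) ∨
     ((univ.filter fun i => (π ^ 41) i = i).card = 44 ∧ (univ.filter fun i => (π ^ 41) i = i ∧ (π ^ 3) i = i).card = 3)) := by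
  have hcard : (Fintype.card ι : ℤ) ≠ 0 := by rw [hι]; norm_num
  exact ⟨order123_cols hH hι haut hπ hκ h41 h3,
    order123_cols (isHadamard_transpose hH hcard) hι (isSignedAut_transpose haut) hκ hπ h41.symm h3.symm⟩

/-- columns, order 65 -/
lemma order65_cols (hH : IsHadamardMatrix H) (hι : Fintype.card ι = 668)
    {π κ : Equiv.Perm ι} {d e : ι → ℤ} (haut : IsSignedAut H π κ d e)
    (hπ : π ^ (5 * 13) = 1) (hκ : κ ^ (5 * 13) = 1) (h13 : π ^ 13 ≠ 1 ∨ κ ^ 13 ≠ 1) (h5 : π ^ 5 ≠ 1 ∨ κ ^ 5 ≠ 1) :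
    ((univ.filter fun j => (κ ^ 13) j = j).card = 108 ∧ (univ.filter fun j => (κ ^ 13) j = j ∧ (κ ^ 5) j = j).card = 4) ∨
    ((univ.filter fun j => (κ ^ 13) j = j).card = 48 ∧ (univ.filter fun j => (κ ^ 13) j = j ∧ (κ ^ 5) j = j).card = 9) := by
  have hcard : (Fintype.card ι : ℤ) ≠ 0 := by rw [hι]; norm_num
  have hπ13 : (π ^ 13) ^ 5 = 1 := by rw [← pow_mul]; exact hπ
  have hκ13 : (κ ^ 13) ^ 5 = 1 := by rw [← pow_mul]; exact hκ
  have hπ5 : (π ^ 5) ^ 13 = 1 := by rw [← pow_mul]; exact hπ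
  have hκ5 : (κ ^ 5) ^ 13 = 1 := by rw [← pow_mul]; exact hκ
  have hne13 : π ^ 13 ≠ 1 := fst_pow_ne_one hH hcard haut (by decide : Odd 5) hκ13 h13
  obtain ⟨⟨cC1, cC2, cCm⟩, ⟨cR1, cR2, cRm⟩⟩ := census5 hH hι (isSignedAut_pow haut 13) hπ13 hκ13 hne13
  obtain ⟨eRC, h44⟩ := hadamard668_signedAut_fixedRows hH hι 13 (by norm_num) (by norm_num) (π ^ 5) (κ ^ 5) _ _
    (isSignedAut_pow haut 5) hπ5 hκ5 h5
  have h44R : (univ.filter fun i => (π ^ 5) i = i).card = 44 := by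
    rcases h44 with ⟨-, h⟩ | ⟨h, -⟩ | ⟨h, -⟩ | ⟨h, -⟩ | ⟨h, -⟩ | ⟨h, -⟩ <;> first | exact h | norm_num at h
  have h44C : (univ.filter fun j => (κ ^ 5) j = j).card = 44 := by rw [← eRC]; exact h44R
  obtain ⟨c1, ⟨a, ha⟩, c2, ⟨b, hb⟩, -, -⟩ := counting_cols κ (by norm_num : (5 : ℕ).Prime) (by norm_num : (13 : ℕ).Prime) hκ
  have hbd := composite_fixed_bound hH hι haut (by norm_num : (5 : ℕ).Prime) (by norm_num : (13 : ℕ).Prime) (by norm_num)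
    (by decide : Odd (5 * 13)) hπ hκ (by omega)
  have hF : (univ.filter fun j => (κ ^ 13) j = j ∧ (κ ^ 5) j = j).card = 4 ∨
      (univ.filter fun j => (κ ^ 13) j = j ∧ (κ ^ 5) j = j).card = 9 := by
    clear cR1 cR2 cRm cC1 cC2 cCm c2 hb h44R eRC; omega
  clear cR1 cR2 cRm h44R
  obtain ⟨t, ht⟩ : ∃ t : ℕ, (univ.filter fun j => (κ ^ 13) j = j).card = 10 * t + 8 :=
    ⟨(univ.filter fun j => (κ ^ 13) j = j).card / 10, by omega⟩
  clear cCm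
  rcases hF with hF | hF
  · left; refine ⟨?_, hF⟩; rw [hF] at c2; omega
  · right; refine ⟨?_, hF⟩; rw [hF] at c2; omega

/-- **order 65 = 5·13**: `(#Fix of the 5-part, #(both)) ∈ {(108, 4), (48, 9)}` on columns and on rows. -/
theorem hadamard668_order65_structure (hH : IsHadamardMatrix H) (hι : Fintype.card ι = 668)
    (π κ : Equiv.Perm ι) (d e : ι → ℤ) (haut : IsSignedAut H π κ d e)
    (hπ : π ^ (5 * 13) = 1) (hκ : κ ^ (5 * 13) = 1) (h13 : π ^ 13 ≠ 1 ∨ κ ^ 13 ≠ 1) (h5 : π ^ 5 ≠ 1 ∨ κ ^ 5 ≠ 1) :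
    (((univ.filter fun j => (κ ^ 13) j = j).card = 108 ∧ (univ.filter fun j => (κ ^ 13) j = j ∧ (κ ^ 5) j = j).card = 4) ∨
     ((univ.filter fun j => (κ ^ 13) j = j).card = 48 ∧ (univ.filter fun j => (κ ^ 13) j = j ∧ (κ ^ 5) j = j).card = 9)) ∧
    (((univ.filter fun i => (π ^ 13) i = i).card = 108 ∧ (univ.filter fun i => (π ^ 13) i = i ∧ (π ^ 5) i = i).card = 4) ∨
     ((univ.filter fun i => (π ^ 13) i = i).card = 48 ∧ (univ.filter fun i => (π ^ 13) i = i ∧ (π ^ 5) i = i).card = 9)) := by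
  have hcard : (Fintype.card ι : ℤ) ≠ 0 := by rw [hι]; norm_num
  exact ⟨order65_cols hH hι haut hπ hκ h13 h5,
    order65_cols (isHadamard_transpose hH hcard) hι (isSignedAut_transpose haut) hκ hπ h13.symm h5.symm⟩

/-- columns, order 77 -/
lemma order77_cols (hH : IsHadamardMatrix H) (hι : Fintype.card ι = 668)
    {π κ : Equiv.Perm ι} {d e : ι → ℤ} (haut : IsSignedAut H π κ d e)
    (hπ : π ^ (7 * 11) = 1) (hκ : κ ^ (7 * 11) = 1) (h11 : π ^ 11 ≠ 1 ∨ κ ^ 11 ≠ 1) (h7 : π ^ 7 ≠ 1 ∨ κ ^ 7 ≠ 1) :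
    ((univ.filter fun j => (κ ^ 11) j = j).card = 24 ∧ (univ.filter fun j => (κ ^ 7) j = j).card = 30 ∧
        (univ.filter fun j => (κ ^ 11) j = j ∧ (κ ^ 7) j = j).card = 2) ∨
    ((univ.filter fun j => (κ ^ 11) j = j).card = 52 ∧ (univ.filter fun j => (κ ^ 7) j = j).card = 8 ∧
        (univ.filter fun j => (κ ^ 11) j = j ∧ (κ ^ 7) j = j).card = 8) ∨
    ((univ.filter fun j => (κ ^ 11) j = j).card = 80 ∧ (univ.filter fun j => (κ ^ 7) j = j).card = 52 ∧
        (univ.filter fun j => (κ ^ 11) j = j ∧ (κ ^ 7) j = j).card = 3) := by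
  have hcard : (Fintype.card ι : ℤ) ≠ 0 := by rw [hι]; norm_num
  have hπ11 : (π ^ 11) ^ 7 = 1 := by rw [← pow_mul]; exact hπ
  have hκ11 : (κ ^ 11) ^ 7 = 1 := by rw [← pow_mul]; exact hκ
  have hπ7 : (π ^ 7) ^ 11 = 1 := by rw [← pow_mul]; exact hπ
  have hκ7 : (κ ^ 7) ^ 11 = 1 := by rw [← pow_mul]; exact hκ
  have hne11 : π ^ 11 ≠ 1 := fst_pow_ne_one hH hcard haut (by decide : Odd 7) hκ11 h11
  have hne7 : π ^ 7 ≠ 1 := fst_pow_ne_one hH hcard haut (by decide : Odd 11) hκ7 h7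
  obtain ⟨c7C, c7R⟩ := census7 hH hι (isSignedAut_pow haut 11) hπ11 hκ11 hne11
  obtain ⟨c11C, c11R⟩ := census11 hH hι (isSignedAut_pow haut 7) hπ7 hκ7 hne7
  obtain ⟨c1, ⟨a, ha⟩, c2, ⟨b, hb⟩, -, -⟩ := counting_cols κ (by norm_num : (7 : ℕ).Prime) (by norm_num : (11 : ℕ).Prime) hκ
  have hbd := composite_fixed_bound hH hι haut (by norm_num : (7 : ℕ).Prime) (by norm_num : (11 : ℕ).Prime) (by norm_num)
    (by decide : Odd (7 * 11)) hπ hκ (by rcases c7R with h | h | h | h | h <;> rcases c11R with h' | h' | h' <;> omega)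
  rcases c7C with h | h | h | h | h <;> rcases c11C with h' | h' | h' <;> omega

/-- **order 77 = 7·11**: `(#Fix of the 7-part, #Fix of the 11-part, #(both)) ∈ {(24, 30, 2), (52, 8, 8), (80, 52, 3)}` on
columns and on rows. -/
theorem hadamard668_order77_structure (hH : IsHadamardMatrix H) (hι : Fintype.card ι = 668)
    (π κ : Equiv.Perm ι) (d e : ι → ℤ) (haut : IsSignedAut H π κ d e)
    (hπ : π ^ (7 * 11) = 1) (hκ : κ ^ (7 * 11) = 1) (h11 : π ^ 11 ≠ 1 ∨ κ ^ 11 ≠ 1) (h7 : π ^ 7 ≠ 1 ∨ κ ^ 7 ≠ 1) :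
    (((univ.filter fun j => (κ ^ 11) j = j).card = 24 ∧ (univ.filter fun j => (κ ^ 7) j = j).card = 30 ∧
        (univ.filter fun j => (κ ^ 11) j = j ∧ (κ ^ 7) j = j).card = 2) ∨
     ((univ.filter fun j => (κ ^ 11) j = j).card = 52 ∧ (univ.filter fun j => (κ ^ 7) j = j).card = 8 ∧
        (univ.filter fun j => (κ ^ 11) j = j ∧ (κ ^ 7) j = j).card = 8) ∨
     ((univ.filter fun j => (κ ^ 11) j = j).card = 80 ∧ (univ.filter fun j => (κ ^ 7) j = j).card = 52 ∧
        (univ.filter fun j => (κ ^ 11) j = j ∧ (κ ^ 7) j = j).card = 3)) ∧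
    (((univ.filter fun i => (π ^ 11) i = i).card = 24 ∧ (univ.filter fun i => (π ^ 7) i = i).card = 30 ∧
        (univ.filter fun i => (π ^ 11) i = i ∧ (π ^ 7) i = i).card = 2) ∨
     ((univ.filter fun i => (π ^ 11) i = i).card = 52 ∧ (univ.filter fun i => (π ^ 7) i = i).card = 8 ∧
        (univ.filter fun i => (π ^ 11) i = i ∧ (π ^ 7) i = i).card = 8) ∨
     ((univ.filter fun i => (π ^ 11) i = i).card = 80 ∧ (univ.filter fun i => (π ^ 7) i = i).card = 52 ∧
        (univ.filter fun i => (π ^ 11) i = i ∧ (π ^ 7) i = i).card = 3)) := by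
  have hcard : (Fintype.card ι : ℤ) ≠ 0 := by rw [hι]; norm_num
  exact ⟨order77_cols hH hι haut hπ hκ h11 h7,
    order77_cols (isHadamard_transpose hH hcard) hι (isSignedAut_transpose haut) hκ hπ h11.symm h7.symm⟩

end compositeB

end Summit.Ventures.DiscreteObjects.Hadamard
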